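import Summits.NavierStokesRegularity.NavierStokesRegularity.Theses.PumpContinuation
import Summits.NavierStokesRegularity.NavierStokesRegularity.Theorems.PerpetualPumpEulerTypeIGlueDuhamel
import Literature.Analysis.FluidPDE.TaoAveragedSobolevProofs
import Literature.Analysis.FluidPDE.TaoCascadeProjection

/-!
# Crux `EulerProximatePump` (stmt-NavierStokesRegularity-18302), negative side:
# the heat equation lies on admissible segments and never blows up

Negative-side support lemmas of the crux disprover (cdisprove, cycle 1, 2026-08-17). Nothing here
closes the item (`--supports`); no statement of the route is changed; no conclusion asserts a Theses
decl positively. Notation as in `DoorObstructions.lean`: `tIB[T, M]` is the crux's matrix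
(Schwartz-data `H¹⁰_df`-mild Type-I blow-up of the form `T` at ceiling `M`, no mild extension) and
`seg[𝒜, θ]` the segment form `(1-θ)B̃_𝒜 + θB`.

Small-model facts about Tao's class as quantified in the crux (symmetric cancelling averaging data):

* `continuousInH10On_heat`, `isMildSolutionFor_zeroForm_heat`, `eq_heat_of_isMildSolutionFor_zeroForm`
  — the free heat flow `t ↦ e^{tΔ}a` of an `H¹⁰_df` field is a GLOBAL `H¹⁰_df`-mild solution of the
  zero form (strong continuity of `e^{tΔ}` in `H¹⁰`, dominated convergence on the Fourier side), and
  the only one from its datum (test the difference against itself: `⟨d, d⟩ = 0`, `d` real).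
* `not_tIB_zeroForm` — hence **the zero form (heat equation) admits no bounded-temperature blow-up**
  at any ceiling: every mild solution from a Schwartz datum extends (by the heat flow of its own
  initial slice `u 0 ∈ H¹⁰_df`; the datum itself need not be placed in `H¹⁰_df`).
* `zero_isSymmetric`, `zero_hasCancellation`, `seg_zeroDatum`, `seg_zeroDatum_zero` — the ZERO
  datum (`mᵢ ≡ 0`, accepted `AveragingDatum.zero`) is admissible and its segment is `T_θ = θ·B`,
  passing through the heat equation at `θ = 0` (and through positive multiples of `B` for `θ > 0`: a
  second collapse of the Door onto Navier–Stokes Type-I blow-up, after the Euler datum).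
* `not_tIB_seg_zeroDatum_zero`, `not_forall_admissible_seedIgnited` — **refuted natural
  strengthening**: it is NOT the case that every symmetric cancelling datum pumps at Tao's end of
  its segment (`θ = 0`); the route's seed `0 ∈ S_M` (birth skeleton `SeedOpen`, clopen on `[0,θ₁]`)
  and every "blow-up set is an interval from 0" picture are datum-specific, not class-wide.

## References

* T. Tao, J. Amer. Math. Soc. 29 (2016), arXiv:1402.0290v3, §1.1 (1.5), (1.13), (1.15).
  [`Tao2016AveragedNS`]
-/

noncomputable section

-- the nested summit namespace `…NavierStokesRegularity.NavierStokesRegularity…` is the tree's layout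
-- (D-0017), so the duplicated-namespace linter must be silenced for every declaration below
set_option linter.dupNamespace false

namespace Summit.NavierStokesRegularity.NavierStokesRegularity.Theorems.EulerProximatePump.Negative

open MeasureTheory Set Filter Topology
open scoped ENNReal SchwartzMap
open Literature.Analysis.FluidPDE Literature.Analysis.FluidPDE.Tao2016
open Literature.Analysis.FunctionSpaces (eFourierSobolevNorm)
open Summit.NavierStokesRegularity.NavierStokesRegularity.Theses.PumpContinuation
open Summit.NavierStokesRegularity.NavierStokesRegularity.Theorems.PerpetualPumpEulerTypeIGlue
  (fourierFn_heat_sub_heat)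

/-- Local notation for physical / frequency space `ℝ³`. -/
local notation "ℝ³" => EuclideanSpace ℝ (Fin 3)

/-- Schwartz-data `H¹⁰_df`-mild Type-I blow-up of the form `T` at ceiling `M` with no mild extension —
verbatim the matrix of the crux. -/
local notation3 "tIB[" T ", " M "]" =>
  ∃ u₀ : SchwartzMap (EuclideanSpace ℝ (Fin 3)) (EuclideanSpace ℝ (Fin 3)),
    Literature.Analysis.FluidPDE.VectorCalculus.IsDivFree ⇑u₀ ∧ ∃ S : ℝ, 0 < S ∧
    ∃ u : ℝ → Literature.Analysis.FluidPDE.Tao2016.L2C,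
      Literature.Analysis.FluidPDE.Tao2016.IsMildSolutionFor T
        (Literature.Analysis.FluidPDE.Tao2016.schwartzL2 u₀) (Set.Ico 0 S) u ∧
      (∀ t ∈ Set.Ico 0 S, MeasureTheory.eLpNorm (u t) ⊤ MeasureTheory.volume ≤
        ENNReal.ofReal (M / Real.sqrt (S - t))) ∧
      ¬ ∃ S' : ℝ, S < S' ∧ ∃ v : ℝ → Literature.Analysis.FluidPDE.Tao2016.L2C,
        Literature.Analysis.FluidPDE.Tao2016.IsMildSolutionFor T
          (Literature.Analysis.FluidPDE.Tao2016.schwartzL2 u₀) (Set.Ico 0 S') v ∧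
        ∀ t ∈ Set.Ico 0 S, v t = u t

/-- The segment form `T_θ = (1-θ)·B̃_𝒜 + θ·B` of route PumpContinuation (verbatim). -/
local notation3 "seg[" 𝒜 ", " θ "]" =>
  fun (a b c : Literature.Analysis.FluidPDE.Tao2016.L2C) =>
    ((1 - θ : ℝ) : ℂ) * AveragingDatum.form 𝒜 a b c +
      ((θ : ℝ) : ℂ) * Literature.Analysis.FluidPDE.Tao2016.eulerForm a b c

/-! ### The free heat flow is a global mild solution of the zero form, and the only one -/

/-- The squared `H¹⁰` norm as a Fourier-side integral, for an `H¹⁰` field. [folklore] -/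
theorem lintegral_weight_fourierFn_lt_top {a : L2C} (ha : eFourierSobolevNorm 10 a < ∞) :
    ∫⁻ ξ : ℝ³, ENNReal.ofReal ((1 + ‖ξ‖ ^ 2) ^ (10 : ℝ)) * ‖fourierFn a ξ‖ₑ ^ 2 < ∞ := by
  by_contra h
  rw [not_lt, top_le_iff] at h
  unfold eFourierSobolevNorm at ha
  change (∫⁻ ξ : ℝ³, ENNReal.ofReal ((1 + ‖ξ‖ ^ 2) ^ (10 : ℝ)) * ‖fourierFn a ξ‖ₑ ^ 2) ^ (1 / 2 : ℝ) < ∞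
    at ha
  rw [h, ENNReal.top_rpow_of_pos (by norm_num)] at ha
  exact lt_irrefl _ ha

/-- **Strong continuity of the heat flow in `H¹⁰`**: for `‖a‖_{H¹⁰} < ∞`, `t ↦ e^{tΔ}a` is continuous
into `H¹⁰` on every time set (dominated convergence on the Fourier side:
`(1+|ξ|²)¹⁰ |e^{-4π²t|ξ|²} - e^{-4π²t₀|ξ|²}|² |â|² ≤ 4 (1+|ξ|²)¹⁰ |â|²`, integrable). [folklore] -/
theorem continuousInH10On_heat {a : L2C} (ha : eFourierSobolevNorm 10 a < ∞) (I : Set ℝ) :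
    ContinuousInH10On I (fun t => heat t a) := by
  intro t₀ _
  refine Tendsto.mono_left ?_ nhdsWithin_le_nhds
  -- the squared `H¹⁰` distance as a Fourier-side integral
  set W : ℝ³ → ℝ≥0∞ := fun ξ => ENNReal.ofReal ((1 + ‖ξ‖ ^ 2) ^ (10 : ℝ)) with hW
  have hsq : ∀ t, eFourierSobolevNorm 10 (heat t a - heat t₀ a) =
      (∫⁻ ξ, W ξ * (‖heatSymbol t ξ - heatSymbol t₀ ξ‖ₑ ^ 2 * ‖fourierFn a ξ‖ₑ ^ 2)) ^ (1 / 2 : ℝ) := by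
    intro t
    unfold eFourierSobolevNorm
    congr 1
    refine lintegral_congr_ae ?_
    filter_upwards [fourierFn_heat_sub_heat t t₀ a] with ξ hξ
    change W ξ * ‖fourierFn (heat t a - heat t₀ a) ξ‖ₑ ^ 2 = _
    rw [hξ, enorm_smul, mul_pow]
  -- dominated convergence for the integral
  have hlim : Tendsto (fun t => ∫⁻ ξ, W ξ * (‖heatSymbol t ξ - heatSymbol t₀ ξ‖ₑ ^ 2 * ‖fourierFn a ξ‖ₑ ^ 2))
      (𝓝 t₀) (𝓝 0) := by
    have hWm : Measurable W := by
      rw [hW]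
      exact ENNReal.measurable_ofReal.comp (by fun_prop)
    have hmeas : ∀ t, AEMeasurable
        (fun ξ => W ξ * (‖heatSymbol t ξ - heatSymbol t₀ ξ‖ₑ ^ 2 * ‖fourierFn a ξ‖ₑ ^ 2)) volume :=
      fun t => hWm.aemeasurable.mul
        (((((continuous_heatSymbol t).sub (continuous_heatSymbol t₀)).aestronglyMeasurable.enorm.pow_const
          2)).mul ((aestronglyMeasurable_fourierFn a).enorm.pow_const 2))
    have hfin : ∫⁻ ξ, W ξ * (4 * ‖fourierFn a ξ‖ₑ ^ 2) ≠ ⊤ := by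
      have h4 : ∫⁻ ξ, W ξ * (4 * ‖fourierFn a ξ‖ₑ ^ 2) = 4 * ∫⁻ ξ, W ξ * ‖fourierFn a ξ‖ₑ ^ 2 := by
        rw [← lintegral_const_mul' _ _ (by norm_num)]
        refine lintegral_congr fun ξ => ?_
        ring
      rw [h4]
      exact ENNReal.mul_ne_top (by norm_num) (lintegral_weight_fourierFn_lt_top ha).ne
    have h0 : (0 : ℝ≥0∞) = ∫⁻ _ξ : ℝ³, 0 := lintegral_zero.symm
    rw [h0]
    refine tendsto_lintegral_filter_of_dominated_convergence' (fun ξ => W ξ * (4 * ‖fourierFn a ξ‖ₑ ^ 2))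
      (Eventually.of_forall hmeas) (Eventually.of_forall fun t => Eventually.of_forall fun ξ => ?_) hfin
      (Eventually.of_forall fun ξ => ?_)
    · -- domination
      refine mul_le_mul' le_rfl (mul_le_mul' ?_ le_rfl)
      have h1 : ‖heatSymbol t ξ - heatSymbol t₀ ξ‖ₑ ≤ 2 := by
        refine (enorm_sub_le).trans ?_
        calc ‖heatSymbol t ξ‖ₑ + ‖heatSymbol t₀ ξ‖ₑ ≤ 1 + 1 :=
              add_le_add (enorm_heatSymbol_le t ξ) (enorm_heatSymbol_le t₀ ξ)
          _ = 2 := by norm_num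
      calc ‖heatSymbol t ξ - heatSymbol t₀ ξ‖ₑ ^ 2 ≤ 2 ^ 2 := by gcongr
        _ = 4 := by norm_num
    · -- pointwise convergence
      have hc : Continuous fun t : ℝ => heatSymbol t ξ :=
        continuous_heatSymbol₂.comp (continuous_id.prodMk continuous_const)
      have ht : Tendsto (fun t => W ξ * (‖heatSymbol t ξ - heatSymbol t₀ ξ‖ₑ ^ 2 * ‖fourierFn a ξ‖ₑ ^ 2))
          (𝓝 t₀) (𝓝 (W ξ * (‖heatSymbol t₀ ξ - heatSymbol t₀ ξ‖ₑ ^ 2 * ‖fourierFn a ξ‖ₑ ^ 2))) := by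
        refine ENNReal.Tendsto.const_mul ?_ (Or.inr ENNReal.ofReal_ne_top)
        refine ENNReal.Tendsto.mul_const (ENNReal.Tendsto.pow ?_) (Or.inr (ENNReal.pow_ne_top enorm_ne_top))
        exact (continuous_enorm.comp (hc.sub continuous_const)).continuousAt.tendsto
      simpa using ht
  -- back to the norm
  have h2 : Tendsto (fun t => (∫⁻ ξ, W ξ * (‖heatSymbol t ξ - heatSymbol t₀ ξ‖ₑ ^ 2 * ‖fourierFn a ξ‖ₑ ^ 2)) ^
      (1 / 2 : ℝ)) (𝓝 t₀) (𝓝 (0 ^ (1 / 2 : ℝ))) :=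
    (ENNReal.continuous_rpow_const.tendsto 0).comp hlim
  rw [ENNReal.zero_rpow_of_pos (by norm_num)] at h2
  refine h2.congr fun t => ?_
  rw [hsq]

/-- **The free heat flow of an `H¹⁰_df` field is a global `H¹⁰_df`-mild solution of the zero form**
`∂ₜu = Δu`, from its own datum, on every time set. [folklore] -/
theorem isMildSolutionFor_zeroForm_heat {a : L2C} (ha : MemH10df a) (I : Set ℝ) :
    IsMildSolutionFor (fun _ _ _ => 0) a I (fun t => heat t a) :=
  ⟨fun t _ => ha.heat t, continuousInH10On_heat ha.1 I, fun t _ w _ => by simp⟩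

/-- **Uniqueness for the zero form**: an `H¹⁰_df`-mild solution `u` of `∂ₜu = Δu` on `I ∋ 0` (any
datum `u₀ ∈ L²`) is the heat flow of its initial slice, `u t = e^{tΔ}(u 0)` for `t ∈ I`: both sides
lie in `H¹⁰_df` and have the same pairings against `H¹⁰_df` (`⟨e^{tΔ}(u 0), w⟩ = ⟨u 0, e^{tΔ}w⟩ =
⟨u₀, e^{tΔ}w⟩ = ⟨e^{tΔ}u₀, w⟩`), so their (real) difference `d` has `⟨d, d⟩ = 0`. [folklore] -/
theorem eq_heat_of_isMildSolutionFor_zeroForm {u₀ : L2C} {I : Set ℝ} {u : ℝ → L2C}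
    (hu : IsMildSolutionFor (fun _ _ _ => 0) u₀ I u) (h0 : (0 : ℝ) ∈ I) {t : ℝ} (ht : t ∈ I) :
    u t = heat t (u 0) := by
  have ha : MemH10df (u 0) := hu.1 0 h0
  -- same pairings against `H¹⁰_df`
  have hpair : ∀ w, MemH10df w → pairing (u t) w = pairing (heat t (u 0)) w := by
    intro w hw
    have h := hu.2.2 t ht w hw
    simp only [intervalIntegral.integral_zero, add_zero] at h
    rw [h, pairing_heat_left, pairing_heat_left]
    exact (hu.initial h0 (hw.heat t)).symm
  -- the difference is a real `H¹⁰_df` field orthogonal to itself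
  have hd : MemH10df (u t - heat t (u 0)) := (hu.1 t ht).sub (ha.heat t)
  have hself : pairing (u t - heat t (u 0)) (u t - heat t (u 0)) = 0 := by
    rw [pairing_sub_left, hpair _ hd, sub_self]
  exact sub_eq_zero.1 (eq_zero_of_pairing_self_eq_zero hd.2.1 hself)

/-- **The zero form (heat equation) has no bounded-temperature blow-up**, at any ceiling: a mild
solution `u` on `[0,S)` from a Schwartz datum is extended to `[0,S+1)` by the heat flow of its initial
slice `u 0 ∈ H¹⁰_df` (a mild solution from the same datum, since `⟨u 0, ·⟩ = ⟨u₀, ·⟩` on `H¹⁰_df`,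
and equal to `u` on `[0,S)` by uniqueness). [folklore] -/
theorem not_tIB_zeroForm (M : ℝ) : ¬ tIB[fun _ _ _ => (0 : ℂ), M] := by
  rintro ⟨u₀, -, S, hS, u, hu, -, hno⟩
  have h0 : (0 : ℝ) ∈ Ico 0 S := ⟨le_rfl, hS⟩
  have ha : MemH10df (u 0) := hu.1 0 h0
  refine hno ⟨S + 1, by linarith, fun t => heat t (u 0), ⟨fun t _ => ha.heat t,
    continuousInH10On_heat ha.1 _, fun t _ w hw => ?_⟩, fun t ht => ?_⟩
  · simp only [intervalIntegral.integral_zero, add_zero]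
    rw [pairing_heat_left, pairing_heat_left]
    exact hu.initial h0 (hw.heat t)
  · exact (eq_heat_of_isMildSolutionFor_zeroForm hu h0 ht).symm

/-! ### The zero datum: an admissible segment through the heat equation -/

/-- The zero datum (`mᵢ ≡ 0`, form `≡ 0`) is symmetric. [folklore] -/
theorem zero_isSymmetric : AveragingDatum.zero.IsSymmetric := fun u v w _ _ _ => by
  rw [AveragingDatum.zero_form, AveragingDatum.zero_form]

/-- The zero datum has the cancellation property. [folklore] -/
theorem zero_hasCancellation : AveragingDatum.zero.HasCancellation := fun u _ =>
  AveragingDatum.zero_form u u u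

/-- **The segment of the zero datum is `T_θ = θ·B`** (a positive multiple of the Navier–Stokes form
for `θ > 0`). [folklore] -/
theorem seg_zeroDatum (θ : ℝ) :
    seg[AveragingDatum.zero, θ] = fun a b c => ((θ : ℝ) : ℂ) * eulerForm a b c := by
  funext a b c
  simp [AveragingDatum.zero_form]

/-- At `θ = 0` the segment of the zero datum is the zero form (heat equation). [folklore] -/
theorem seg_zeroDatum_zero : seg[AveragingDatum.zero, (0 : ℝ)] = fun _ _ _ => (0 : ℂ) := by
  funext a b c
  simp [AveragingDatum.zero_form]

/-- Tao's end `θ = 0` of the zero datum's segment carries no bounded-temperature blow-up. [folklore] -/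
theorem not_tIB_seg_zeroDatum_zero (M : ℝ) : ¬ tIB[seg[AveragingDatum.zero, (0 : ℝ)], M] := by
  rw [seg_zeroDatum_zero]
  exact not_tIB_zeroForm M

/-- **Refuted natural strengthening (class-wide seed)**: it is NOT true that every symmetric
cancelling averaging datum has a Schwartz-data `H¹⁰_df`-mild Type-I blow-up with no mild extension at
Tao's end `θ = 0` of its segment (witness: the zero datum, whose end is the heat equation). The seed
`0 ∈ S_M` of the route's clopen skeleton is a property of the cascade datum, not of the class. [folklore] -/
theorem not_forall_admissible_seedIgnited :
    ¬ ∀ 𝒜 : AveragingDatum, 𝒜.IsSymmetric → 𝒜.HasCancellation →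
      ∃ M : ℝ, tIB[seg[𝒜, (0 : ℝ)], M] := by
  intro h
  obtain ⟨M, hM⟩ := h AveragingDatum.zero zero_isSymmetric zero_hasCancellation
  exact not_tIB_seg_zeroDatum_zero M hM

end Summit.NavierStokesRegularity.NavierStokesRegularity.Theorems.EulerProximatePump.Negative

end
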